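import Literature.NumberTheory.Transcendental.RoySmallValueDistanceForms
import Literature.NumberTheory.Transcendental.RoySmallValueDivisionRec
import HarnessLib

/-!
# Roy's small value estimate for `𝔾ₐ × 𝔾ₘ` — Lemma 4.4 and Proposition 4.5 (lower bounds for `|I_D^{(γ,T)}|_α`)

Topic `Literature/NumberTheory/Transcendental`. Part of the formalisation of the proof of Roy 2013,
Theorem 1.1 (named fact `roy2013_thm_1_1`, `RoySmallValueEstimates.lean`). Source: D. Roy,
*A small value estimate for `𝔾ₐ × 𝔾ₘ`*, Mathematika 59 (2013) 333–363 = arXiv:1301.0663, §4,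
Lemma 4.4 and Proposition 4.5 (pp. 11–12 of the arXiv text):

> **Proposition 4.5.** With `3 ≤ D ≤ T ≤ binom(⌊D/3⌋+1, 2)` and `α ∈ ℙ²(ℂ)` with representative
> of norm 1: `dist(α,(1:γ))^T ≤ c₅^T T^{6T log T} |I_D^{(γ,T)}|_α`; and if moreover
> `dist(α,(1:γ)) ≤ (2c₂)⁻¹`: `dist(α, A_γ) ≤ c₄ c₅^T T^{6T log T} |I_D^{(γ,T)}|_α`.

Here `|I_D^{(γ,T)}|_α = sup{|P(α)| : P ∈ I_D^{(γ,T)}, ‖P‖ ≤ 1}`. We prove both estimates in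
**test form** — exhibiting an element `P ≠ 0` of `I_D^{(γ,T)}` (`P ∈ ℂ[X]_D ∩ vanIdeal ξ η T`)
with `|P(α)|/‖P‖` at least the required quantity — which is exactly how the Proposition is used
in Step 2 of §7 (through `sup_{P ∈ 𝒞_D} |P(α)| ≥ |I_D^{(γ,T)}|_α`); the printed proof of
Lemma 4.4 produces such a `P` as one of the `P_ν` of the decomposition `Q = ∑ X^ν P_ν` of
Proposition 3.7 ("weighted pigeonhole", `exists_good_component`). The factor `T^{6T log T}` is our
`Λ(T,T)^k` from `prop_3_7_depth` (depth `k` with `2^k T ≤ 3^k D`), and the data `L` with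
`binom(L+1,2) < T ≤ binom(L+2,2)`, `3(L+1) ≤ D` replace `T ≤ binom(⌊D/3⌋+1, 2)` as there.

* `prop_4_5_i` — `‖P‖ dist(α,(1:γ))^T ≤ 2^T Λ(T,T)^k |P(α)|` (via `M^T`, `M` the linear form of
  (4.1));
* `prop_4_5_ii` — `‖P‖ dist(α, A_γ) ≤ (2c₂)^T (1 + c₂e^{1+c₂}) Λ(T,T)^k |P(α)| +
  ‖P‖ c₂e^{c₂}(2c₂²)^T dist(α,(1:γ))^T` (via Roy's `Q`, his (4.3)–(4.4)).

Everything here is proved; no definitions, no new named facts.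

## References

* [Roy2013] D. Roy, *A small value estimate for 𝔾ₐ × 𝔾ₘ*, Mathematika 59 (2013), 333–363
  (arXiv:1301.0663), §4, Lemma 4.4, Proposition 4.5.
-/

noncomputable section

open MvPolynomial Finset Complex

namespace Literature.NumberTheory.Transcendental

namespace Roy2013

open Nesterenko

/-! ### From a decomposition `Q = ∑ X^ν P_ν` to one good `P_ν` (Lemma 4.4) -/

/-- `|X^ν(α)| ≤ 1` when all `|αᵢ| ≤ 1`. [folklore] -/
theorem norm_aeval_monomial_one_le {α : Fin 3 → ℂ} (hα : ∀ i, ‖α i‖ ≤ 1) (ν : Fin 3 →₀ ℕ) :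
    ‖aeval α (monomial ν (1 : ℂ))‖ ≤ 1 := by
  rw [aeval_monomial, map_one, one_mul, Finsupp.prod, norm_prod]
  exact Finset.prod_le_one (fun _ _ => norm_nonneg _) fun i _ => by
    rw [norm_pow]; exact pow_le_one₀ (norm_nonneg _) (hα i)

/-- `𝓛(P) = 0` forces `P = 0`. [folklore] -/
theorem eq_zero_of_l1Norm_eq_zero {P : CX} (h : l1Norm P = 0) : P = 0 := by
  by_contra hP
  exact absurd ((maxNorm_le_l1Norm P).trans_eq h) (not_le.mpr (maxNorm_pos hP))

/-- **Roy 2013, Lemma 4.4, in test form ("weighted pigeonhole")**: if `Q = ∑_{ν ∈ E} X^ν P_ν`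
with `∑ 𝓛(P_ν) ≤ S`, `Q ≠ 0`, and all `|αᵢ| ≤ 1`, then some `P_ν ≠ 0` has
`𝓛(P_ν) |Q(α)| ≤ S |P_ν(α)|` (Roy: `|Q(α)| ≤ ∑ |P_ν(α)| ≤ c ∑ 𝓛(P_ν) |I_D^{(γ,T)}|_α`).
[cite: Roy2013, Lemma 4.4] -/
theorem exists_good_component {α : Fin 3 → ℂ} (hα : ∀ i, ‖α i‖ ≤ 1) (E : Finset (Fin 3 →₀ ℕ))
    (P : (Fin 3 →₀ ℕ) → CX) {Q : CX} (hsum : ∑ ν ∈ E, monomial ν (1 : ℂ) * P ν = Q) (hQ : Q ≠ 0)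
    {S : ℝ} (hS : ∑ ν ∈ E, l1Norm (P ν) ≤ S) :
    ∃ ν ∈ E, P ν ≠ 0 ∧ l1Norm (P ν) * ‖aeval α Q‖ ≤ S * ‖aeval α (P ν)‖ := by
  have hR : ‖aeval α Q‖ ≤ ∑ ν ∈ E, ‖aeval α (P ν)‖ := by
    rw [← hsum, map_sum]
    refine (norm_sum_le _ _).trans (Finset.sum_le_sum fun ν _ => ?_)
    rw [map_mul, norm_mul]
    exact mul_le_of_le_one_left (norm_nonneg _) (norm_aeval_monomial_one_le hα ν)
  have hpos : 0 < ∑ ν ∈ E, l1Norm (P ν) := by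
    by_contra h
    have h0 : ∀ ν ∈ E, l1Norm (P ν) = 0 := fun ν hν =>
      le_antisymm ((Finset.single_le_sum (fun ν _ => l1Norm_nonneg (P ν)) hν).trans (not_lt.mp h))
        (l1Norm_nonneg _)
    apply hQ
    rw [← hsum]
    exact Finset.sum_eq_zero fun ν hν => by rw [eq_zero_of_l1Norm_eq_zero (h0 ν hν), mul_zero]
  obtain ⟨ν, hν, hg, hineq⟩ := exists_weighted_pigeonhole E (fun ν => ‖aeval α (P ν)‖)
    (fun ν => l1Norm (P ν)) (fun ν _ => l1Norm_nonneg _)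
    (fun ν _ h => by rw [eq_zero_of_l1Norm_eq_zero h, map_zero, norm_zero]) hpos hR
  refine ⟨ν, hν, fun h => ?_,
    hineq.trans ((mul_le_mul_of_nonneg_left hS (norm_nonneg _)).trans_eq (mul_comm _ _))⟩
  rw [h, l1Norm_zero] at hg
  exact lt_irrefl _ hg

/-! ### Proposition 4.5, first estimate -/

/-- The linear forms `linForm ξ η j` are non-zero (`η ≠ 0` for `j = 2`). [folklore] -/
theorem linForm_ne_zero {ξ η : ℂ} (hη : η ≠ 0) (j : Fin 3) : linForm ξ η j ≠ 0 := by
  intro h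
  fin_cases j
  · have := congr_arg (aeval ![(0 : ℂ), 1, 0]) h
    simp [linForm] at this
  · have := congr_arg (aeval ![(0 : ℂ), 0, 1]) h
    simp [linForm] at this
  · have := congr_arg (aeval ![(0 : ℂ), 1, 0]) h
    simp [linForm, hη] at this

/-- **Roy 2013, Proposition 4.5, first estimate (test form)**: let `γ = (ξ, η)`, `η ≠ 0`,
`L, T, D, k` with `binom(L+1,2) < T ≤ binom(L+2,2)`, `3(L+1) ≤ D ≤ T`, `2^k T ≤ 3^k D`, and
`α` with all `|αᵢ| ≤ 1`. Then there is `P ∈ I_D^{(γ,T)}`, `P ≠ 0`, with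
`‖P‖ dist(α,(1:γ))^T ≤ 2^T Λ(T,T)^k |P(α)|`, `Λ(T,T) = 3(c₁'c₂)^T(16T³)^T`
(Roy: `dist(α,(1:γ))^T ≤ c₅^T T^{6T log T} |I_D^{(γ,T)}|_α`). [cite: Roy2013, Proposition 4.5] -/
theorem prop_4_5_i {ξ η : ℂ} (hη : η ≠ 0) {L T D k : ℕ} (hT₁ : (L + 1).choose 2 < T)
    (hT₂ : T ≤ (L + 2).choose 2) (hD : 3 * (L + 1) ≤ D) (hDT : D ≤ T)
    (hk : 2 ^ k * T ≤ 3 ^ k * D) {α : Fin 3 → ℂ} (hα : ∀ i, ‖α i‖ ≤ 1) :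
    ∃ P : CX, P.IsHomogeneous D ∧ P ∈ vanIdeal ξ η T ∧ P ≠ 0 ∧
      maxNorm P * pdist ξ η α ^ T ≤
        2 ^ T * (3 * (3 * (1 + ‖ξ‖ + ‖η‖⁻¹) * max 1 (max ‖ξ‖ ‖η‖)) ^ T *
          (16 * (T : ℝ) ^ 3) ^ T) ^ k * ‖aeval α P‖ := by
  set Λ : ℝ := 3 * (3 * (1 + ‖ξ‖ + ‖η‖⁻¹) * max 1 (max ‖ξ‖ ‖η‖)) ^ T * (16 * (T : ℝ) ^ 3) ^ T
    with hΛ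
  have hc := one_le_roy_c2 ξ η
  have hc0 : 0 < roy_c2 ξ η := by linarith
  -- the linear form `M` and `Q = M^T`
  obtain ⟨j, hj⟩ := exists_linForm_ge ξ η α
  set M : CX := linForm ξ η j with hM
  have hMh : (M ^ T).IsHomogeneous T := by
    simpa using (isHomogeneous_linForm ξ η j).pow T
  have hMv : M ^ T ∈ vanIdeal ξ η T := by
    simpa using pow_mul_mem_vanIdeal (aeval_one_linForm ξ η j) T 1
  have hMne : M ^ T ≠ 0 := pow_ne_zero _ (linForm_ne_zero hη j)
  have hMl : l1Norm (M ^ T) ≤ (2 * roy_c2 ξ η) ^ T :=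
    (l1Norm_pow_le _ _).trans (pow_le_pow_left₀ (l1Norm_nonneg _) (l1Norm_linForm_le ξ η j) T)
  -- Proposition 3.7
  obtain ⟨P, hP, hsum, hlen⟩ := prop_3_7_depth hη hT₁ hT₂ hD k T hDT hk hMh hMv
  have hS : ∑ ν ∈ finsuppAntidiag (univ : Finset (Fin 3)) (T - D), l1Norm (P ν) ≤
      Λ ^ k * (2 * roy_c2 ξ η) ^ T :=
    hlen.trans (mul_le_mul_of_nonneg_left hMl (by positivity))
  obtain ⟨ν, hν, hPne, hineq⟩ := exists_good_component hα _ P hsum hMne hS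
  refine ⟨P ν, (hP ν hν).1, (hP ν hν).2, hPne, ?_⟩
  -- `|M(α)|^T ≥ (c₂ dist)^T`
  have hval : (roy_c2 ξ η * pdist ξ η α) ^ T ≤ ‖aeval α (M ^ T)‖ := by
    rw [map_pow, norm_pow]
    exact pow_le_pow_left₀ (mul_nonneg hc0.le (pdist_nonneg _ _ _)) hj T
  have h1 : l1Norm (P ν) * (roy_c2 ξ η * pdist ξ η α) ^ T ≤
      Λ ^ k * (2 * roy_c2 ξ η) ^ T * ‖aeval α (P ν)‖ :=
    (mul_le_mul_of_nonneg_left hval (l1Norm_nonneg _)).trans hineq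
  have hmp1 : (roy_c2 ξ η * pdist ξ η α) ^ T = roy_c2 ξ η ^ T * pdist ξ η α ^ T := mul_pow _ _ _
  have hmp2 : (2 * roy_c2 ξ η) ^ T = 2 ^ T * roy_c2 ξ η ^ T := mul_pow _ _ _
  rw [hmp1, hmp2] at h1
  have h2 : l1Norm (P ν) * pdist ξ η α ^ T ≤ 2 ^ T * Λ ^ k * ‖aeval α (P ν)‖ := by
    have hcT : 0 < roy_c2 ξ η ^ T := pow_pos hc0 T
    have : roy_c2 ξ η ^ T * (l1Norm (P ν) * pdist ξ η α ^ T) ≤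
        roy_c2 ξ η ^ T * (2 ^ T * Λ ^ k * ‖aeval α (P ν)‖) := by
      calc roy_c2 ξ η ^ T * (l1Norm (P ν) * pdist ξ η α ^ T)
          = l1Norm (P ν) * (roy_c2 ξ η ^ T * pdist ξ η α ^ T) := by ring
        _ ≤ Λ ^ k * (2 ^ T * roy_c2 ξ η ^ T) * ‖aeval α (P ν)‖ := h1
        _ = roy_c2 ξ η ^ T * (2 ^ T * Λ ^ k * ‖aeval α (P ν)‖) := by ring
    exact le_of_mul_le_mul_left this hcT
  exact (mul_le_mul_of_nonneg_right (maxNorm_le_l1Norm _) (pow_nonneg (pdist_nonneg _ _ _) T)).trans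
    h2

/-! ### Proposition 4.5, second estimate -/

/-- `Q ≠ 0`: the coefficient of `X₀^{T-1}X₂` in `Q` is `1`; here detected by evaluation at a
point where the `X₂`-free sum vanishes. [folklore] -/
theorem royQ_ne_zero (ξ η : ℂ) {T : ℕ} (hT : 1 ≤ T) : royQ ξ η T ≠ 0 := by
  intro h
  -- evaluate at `α = (1, ξ, ξ… )`: use `aeval_royQ` at `(1, ξ, 1 + η ∑ …)`
  have h1 := aeval_royQ ξ η hT (α := ![(1 : ℂ), ξ, 1 + η * ∑ i ∈ range T,
    ((i.factorial : ℂ)⁻¹ * (ξ / 1 - ξ) ^ i)]) (by simp)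
  rw [h, map_zero] at h1
  simp at h1

/-- **Roy 2013, Proposition 4.5, second estimate (test form)**: with the hypotheses of
`prop_4_5_i` and moreover `|α₀| ≥ (2c₂)⁻¹`, `dist(α,(1:γ)) ≤ (2c₂)⁻¹` (Lemma 4.1), there is
`P ∈ I_D^{(γ,T)}`, `P ≠ 0`, with
`‖P‖ dist(α, A_γ) ≤ (2c₂)^T (1 + c₂e^{1+c₂}) Λ(T,T)^k |P(α)| + ‖P‖ c₂e^{c₂}(2c₂²)^T dist(α,(1:γ))^T`
(Roy: `dist(α, A_γ) ≤ c₄ c₅^T T^{6T log T} |I_D^{(γ,T)}|_α`, from his (4.3)–(4.4)).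
[cite: Roy2013, Proposition 4.5] -/
theorem prop_4_5_ii {ξ η : ℂ} (hη : η ≠ 0) {L T D k : ℕ} (hT₁ : (L + 1).choose 2 < T)
    (hT₂ : T ≤ (L + 2).choose 2) (hD : 3 * (L + 1) ≤ D) (hDT : D ≤ T)
    (hk : 2 ^ k * T ≤ 3 ^ k * D) {α : Fin 3 → ℂ} (hα : ∀ i, ‖α i‖ ≤ 1)
    (hα0 : (2 * roy_c2 ξ η)⁻¹ ≤ ‖α 0‖) (hd : pdist ξ η α ≤ (2 * roy_c2 ξ η)⁻¹) :
    ∃ P : CX, P.IsHomogeneous D ∧ P ∈ vanIdeal ξ η T ∧ P ≠ 0 ∧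
      maxNorm P * adist ξ η α ≤
        (2 * roy_c2 ξ η) ^ T * (1 + roy_c2 ξ η * Real.exp (1 + roy_c2 ξ η)) *
          (3 * (3 * (1 + ‖ξ‖ + ‖η‖⁻¹) * max 1 (max ‖ξ‖ ‖η‖)) ^ T *
            (16 * (T : ℝ) ^ 3) ^ T) ^ k * ‖aeval α P‖ +
        maxNorm P * (roy_c2 ξ η * Real.exp (roy_c2 ξ η) * (2 * roy_c2 ξ η ^ 2) ^ T *
          pdist ξ η α ^ T) := by
  set Λ : ℝ := 3 * (3 * (1 + ‖ξ‖ + ‖η‖⁻¹) * max 1 (max ‖ξ‖ ‖η‖)) ^ T * (16 * (T : ℝ) ^ 3) ^ T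
    with hΛ
  set c₂ : ℝ := roy_c2 ξ η with hc₂
  have hc : 1 ≤ c₂ := one_le_roy_c2 ξ η
  have hc0 : 0 < c₂ := by linarith
  have hT : 1 ≤ T := by have := Nat.zero_le ((L + 1).choose 2); omega
  have hα0' : 0 < ‖α 0‖ := lt_of_lt_of_le (by positivity) hα0
  have hα0ne : α 0 ≠ 0 := norm_pos_iff.mp hα0'
  have hinvα : ‖α 0‖⁻¹ ≤ 2 * c₂ := by
    rw [inv_le_comm₀ hα0' (by positivity)]; exact hα0
  -- `Q` and Proposition 3.7
  set Q : CX := royQ ξ η T with hQdef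
  have hQh : Q.IsHomogeneous T := isHomogeneous_royQ ξ η hT
  have hQv : Q ∈ vanIdeal ξ η T := royQ_mem_vanIdeal ξ η T
  have hQne : Q ≠ 0 := royQ_ne_zero ξ η hT
  have hQl : l1Norm Q ≤ 1 + c₂ * Real.exp (1 + c₂) := l1Norm_royQ_le ξ η T
  obtain ⟨P, hP, hsum, hlen⟩ := prop_3_7_depth hη hT₁ hT₂ hD k T hDT hk hQh hQv
  have hS : ∑ ν ∈ finsuppAntidiag (univ : Finset (Fin 3)) (T - D), l1Norm (P ν) ≤
      Λ ^ k * (1 + c₂ * Real.exp (1 + c₂)) :=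
    hlen.trans (mul_le_mul_of_nonneg_left hQl (by positivity))
  obtain ⟨ν, hν, hPne, hineq⟩ := exists_good_component hα _ P hsum hQne hS
  refine ⟨P ν, (hP ν hν).1, (hP ν hν).2, hPne, ?_⟩
  -- `δ₁` and the two pieces of `dist(α, A_γ)`
  set δ₁ : ℂ := α 1 / α 0 - ξ with hδ₁
  have hδ₁eq : δ₁ = (α 1 - α 0 * ξ) / α 0 := by rw [hδ₁]; field_simp
  have hδ₁le : ‖δ₁‖ ≤ 2 * c₂ ^ 2 * pdist ξ η α := by
    rw [hδ₁eq, norm_div, div_eq_mul_inv]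
    calc ‖α 1 - α 0 * ξ‖ * ‖α 0‖⁻¹ ≤ (c₂ * pdist ξ η α) * (2 * c₂) :=
          mul_le_mul (norm_sub_xi_le_pdist ξ η α) hinvα (by positivity)
            (mul_nonneg hc0.le (pdist_nonneg _ _ _))
      _ = 2 * c₂ ^ 2 * pdist ξ η α := by ring
  have hδ₁c : ‖δ₁‖ ≤ c₂ := by
    refine hδ₁le.trans ?_
    calc 2 * c₂ ^ 2 * pdist ξ η α ≤ 2 * c₂ ^ 2 * (2 * c₂)⁻¹ :=
          mul_le_mul_of_nonneg_left hd (by positivity)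
      _ = c₂ := by field_simp
  -- (4.3): `|α₂/α₀ - η ∑_{i<T} δ₁ⁱ/i!| = |Q(α)|/|α₀|^T ≤ (2c₂)^T |Q(α)|`
  have hp0 : 0 ≤ pdist ξ η α := pdist_nonneg ξ η α
  have hval : aeval α Q = α 0 ^ T *
      (α 2 / α 0 - η * ∑ i ∈ range T, ((i.factorial : ℂ)⁻¹ * δ₁ ^ i)) :=
    aeval_royQ ξ η hT hα0ne
  have hW : ‖α 2 / α 0 - η * ∑ i ∈ range T, ((i.factorial : ℂ)⁻¹ * δ₁ ^ i)‖ =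
      ‖aeval α Q‖ * (‖α 0‖ ^ T)⁻¹ := by
    have hαT : ‖α 0‖ ^ T ≠ 0 := pow_ne_zero T hα0'.ne'
    rw [hval, norm_mul, norm_pow]
    field_simp
  have h43 : ‖α 2 / α 0 - η * ∑ i ∈ range T, ((i.factorial : ℂ)⁻¹ * δ₁ ^ i)‖ ≤
      (2 * c₂) ^ T * ‖aeval α Q‖ := by
    rw [hW, ← inv_pow, mul_comm]
    exact mul_le_mul_of_nonneg_right
      (pow_le_pow_left₀ (inv_nonneg.mpr (norm_nonneg _)) hinvα T) (norm_nonneg _)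
  -- (4.4): the exponential tail
  have h44 : ‖η * ∑ i ∈ range T, ((i.factorial : ℂ)⁻¹ * δ₁ ^ i) - η * cexp δ₁‖ ≤
      c₂ * Real.exp c₂ * (2 * c₂ ^ 2) ^ T * pdist ξ η α ^ T := by
    rw [← mul_sub, norm_mul, norm_sub_rev]
    have hs : ∑ i ∈ range T, ((i.factorial : ℂ)⁻¹ * δ₁ ^ i) =
        ∑ i ∈ range T, δ₁ ^ i / i.factorial :=
      Finset.sum_congr rfl fun i _ => by rw [div_eq_inv_mul]
    rw [hs]
    calc ‖η‖ * ‖cexp δ₁ - ∑ i ∈ range T, δ₁ ^ i / i.factorial‖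
        ≤ c₂ * (‖δ₁‖ ^ T * Real.exp ‖δ₁‖) :=
          mul_le_mul (norm_le_roy_c2_right ξ η)
            (Complex.norm_exp_sub_sum_le_norm_mul_exp δ₁ T) (norm_nonneg _) hc0.le
      _ ≤ c₂ * ((2 * c₂ ^ 2 * pdist ξ η α) ^ T * Real.exp c₂) := by gcongr
      _ = c₂ * Real.exp c₂ * (2 * c₂ ^ 2) ^ T * pdist ξ η α ^ T := by rw [mul_pow]; ring
  have hadist : adist ξ η α ≤ (2 * c₂) ^ T * ‖aeval α Q‖ +
      c₂ * Real.exp c₂ * (2 * c₂ ^ 2) ^ T * pdist ξ η α ^ T := by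
    have : adist ξ η α = ‖(α 2 / α 0 - η * ∑ i ∈ range T, ((i.factorial : ℂ)⁻¹ * δ₁ ^ i)) +
        (η * ∑ i ∈ range T, ((i.factorial : ℂ)⁻¹ * δ₁ ^ i) - η * cexp δ₁)‖ := by
      rw [adist, ← hδ₁]; congr 1; ring
    rw [this]
    exact (norm_add_le _ _).trans (add_le_add h43 h44)
  -- combine with the pigeonhole inequality
  set B : ℝ := c₂ * Real.exp c₂ * (2 * c₂ ^ 2) ^ T * pdist ξ η α ^ T with hB
  set A : ℝ := (2 * c₂) ^ T * (1 + c₂ * Real.exp (1 + c₂)) * Λ ^ k with hA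
  have hl : l1Norm (P ν) * adist ξ η α ≤ A * ‖aeval α (P ν)‖ + l1Norm (P ν) * B := by
    calc l1Norm (P ν) * adist ξ η α ≤ l1Norm (P ν) * ((2 * c₂) ^ T * ‖aeval α Q‖ + B) :=
          mul_le_mul_of_nonneg_left hadist (l1Norm_nonneg _)
      _ = (2 * c₂) ^ T * (l1Norm (P ν) * ‖aeval α Q‖) + l1Norm (P ν) * B := by ring
      _ ≤ (2 * c₂) ^ T * (Λ ^ k * (1 + c₂ * Real.exp (1 + c₂)) * ‖aeval α (P ν)‖) +
            l1Norm (P ν) * B := by gcongr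
      _ = A * ‖aeval α (P ν)‖ + l1Norm (P ν) * B := by rw [hA]; ring
  -- from `𝓛(P)` to `‖P‖`
  have hm : maxNorm (P ν) ≤ l1Norm (P ν) := maxNorm_le_l1Norm _
  have hm0 : 0 ≤ maxNorm (P ν) := maxNorm_nonneg _
  have hA0 : 0 ≤ A * ‖aeval α (P ν)‖ := by positivity
  by_cases hcase : adist ξ η α ≤ B
  · calc maxNorm (P ν) * adist ξ η α ≤ maxNorm (P ν) * B := mul_le_mul_of_nonneg_left hcase hm0
      _ ≤ A * ‖aeval α (P ν)‖ + maxNorm (P ν) * B := le_add_of_nonneg_left hA0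
  · push Not at hcase
    have : maxNorm (P ν) * (adist ξ η α - B) ≤ l1Norm (P ν) * (adist ξ η α - B) :=
      mul_le_mul_of_nonneg_right hm (by linarith)
    nlinarith

end Roy2013

end Literature.NumberTheory.Transcendental
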